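import Summits.AtomisticToContinuum.HydrodynamicLimit.Theses.InformationPercolationEngine
import Literature.MathematicalPhysics.KineticTheory.TaggedSphereDiffusionCorrector
import Literature.MeasureTheory.Lebesgue.SierpinskiSphereSet
import Summits.AtomisticToContinuum.HydrodynamicLimit.Theorems.SpectralContractionR.Negative.WithoutMeanZero

/-!
# `SpectralContractionR` is false without its measurability hypothesis (load-bearing analysis)

Negative knowledge for the crux `InformationPercolationEngine.SpectralContractionR`
(stmt-AtomisticToContinuum-13913), from the standing disprover's `Cruxes/SpectralContractionR/Disproof.lean`.
`SpectralContractionRWithoutMeasurable` is the crux VERBATIM with `Measurable f →` deleted — which is exactly the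
rev-2 decl `InformationPercolationEngine.SpectralContraction` (stmt-AtomisticToContinuum-13479), refuted-misstated
and then RETIRED from the route file by the rev-3 repair, so that its landed refutation
(`Theorems/InformationPercolationEngineSpectralContractionRefutation.lean`) lost its target constant. This file
re-hosts that refutation against a self-contained copy of the statement, keeping it compilable
(dictionary lemmas `ν = a₁ > 0`, `νM ∈ L¹`, `Z > 0` are reused from `Negative/WithoutMeanZero.lean`):
the ±1 sign pattern `f` of a Sierpiński sphere set `A` (`exists_sierpinskiSphereSet`: not null-measurable,
finite on every round sphere) satisfies the integrability hypothesis (`f² = 1`), satisfies the mean-zero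
hypothesis BY BOCHNER JUNK (`f·νM` not a.e.-measurable ⇒ `∫ = 0`), and has `K f = 1` identically (on each
collision sphere — the Thales sphere with diameter `[v, w]` — `A` is finite and its `ω`-preimage `σ`-null), so
the conclusion reads `Z ≤ cZ`, `Z = ∫ νM > 0`, `c < 1/2`. Hence ANY proof of the crux must use `Measurable f`
(it enters through Fubini / the Carleman representation of `K f`), and `withoutMeasurable_imp` records that the
rev-3 decl is the rev-2 decl plus that single hypothesis. refuter-cdisprove-stmt-AtomisticToContinuum-13913-0
(proof body: refuter-cdisprove-stmt-AtomisticToContinuum-13479-0).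
-/

noncomputable section

open MeasureTheory Metric Real Set Filter Topology
open scoped InnerProductSpace ENNReal Pointwise

namespace Summit.AtomisticToContinuum.HydrodynamicLimit.Theorems

open Literature.MathematicalPhysics.KineticTheory
open Literature.Analysis.FunctionSpaces (maxwellianBeta maxwellianBeta_one maxwellianBeta_pos)
open Literature.Analysis.FluidPDE (globalMaxwellian globalMaxwellian_pos)
open Summit.AtomisticToContinuum.HydrodynamicLimit.Theses.InformationPercolationEngine (SpectralContractionR)

/-- The crux `SpectralContractionR` with the MEASURABILITY hypothesis dropped = verbatim the retired rev-2 decl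
`InformationPercolationEngine.SpectralContraction` (stmt-AtomisticToContinuum-13479). -/
def SpectralContractionRWithoutMeasurable : Prop :=
  ∃ c : ℝ, c < 1 / 2 ∧ let M : Literature.MathematicalPhysics.KineticTheory.V3 → ℝ := Literature.Analysis.FluidPDE.globalMaxwellian; let S : MeasureTheory.Measure (Metric.sphere (0 : Literature.MathematicalPhysics.KineticTheory.V3) 1) := Literature.MathematicalPhysics.KineticTheory.sphereMeasure; let ν : Literature.MathematicalPhysics.KineticTheory.V3 → ℝ := fun v => ∫ w, ∫ ω, Literature.MathematicalPhysics.KineticTheory.hardSphereKernel (v, w) ω * M w ∂S; let K : (Literature.MathematicalPhysics.KineticTheory.V3 → ℝ) → Literature.MathematicalPhysics.KineticTheory.V3 → ℝ := fun f v => (ν v)⁻¹ * ∫ w, ∫ ω, Literature.MathematicalPhysics.KineticTheory.hardSphereKernel (v, w) ω * M w * f (Literature.MathematicalPhysics.KineticTheory.collide ω (v, w)).1 ∂S; ∀ f : Literature.MathematicalPhysics.KineticTheory.V3 → ℝ, MeasureTheory.Integrable (fun v => f v ^ 2 * (ν v * M v)) → ∫ v, f v * (ν v * M v) = 0 → ∫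 v, K f v ^ 2 * (ν v * M v) ≤ c * ∫ v, f v ^ 2 * (ν v * M v)

/-- The rev-3 crux is the rev-2 decl plus `Measurable f →` and nothing else. [folklore] -/
theorem SpectralContractionRWithoutMeasurable.imp :
    SpectralContractionRWithoutMeasurable → SpectralContractionR := by
  rintro ⟨c, hc, h⟩
  exact ⟨c, hc, fun f _ hint hmean => h f hint hmean⟩

namespace SpectralContractionRWithoutMeasurable

open SpectralContractionRWithoutMeanZero (nu_eq nu_pos integrable_nuM integral_nuM_pos)

/-- `ν M` is measurable. [folklore] -/
theorem measurable_nuM :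
    Measurable (fun v : V3 =>
      (∫ w, ∫ ω, hardSphereKernel (v, w) ω * globalMaxwellian w ∂sphereMeasure) * globalMaxwellian v) := by
  have h1 : Continuous (TaggedSphereDiffusion.collisionFrequency (d := Fin 3) 1) :=
    continuous_collisionFrequency one_pos
  have h2 : Continuous (globalMaxwellian : V3 → ℝ) := by
    unfold Literature.Analysis.FluidPDE.globalMaxwellian; fun_prop
  have : (fun v : V3 =>
      (∫ w, ∫ ω, hardSphereKernel (v, w) ω * globalMaxwellian w ∂sphereMeasure) * globalMaxwellian v) =
      fun v => TaggedSphereDiffusion.collisionFrequency (d := Fin 3) 1 v * globalMaxwellian v := by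
    funext v; rw [nu_eq]
  rw [this]
  exact (h1.mul h2).measurable

/-! ### Collision-sphere geometry: a sphere-countable set is invisible to `K` -/

/-- Singletons of the unit sphere are `σ`-null. [folklore] -/
theorem sphereMeasure_singleton (ω₀ : Metric.sphere (0 : V3) 1) :
    (sphereMeasure : Measure (Metric.sphere (0 : V3) 1)) {ω₀} = 0 := by
  unfold sphereMeasure
  rw [Measure.toSphere_apply' _ (measurableSet_singleton ω₀)]
  set S : Submodule ℝ V3 := Submodule.span ℝ {(ω₀ : V3)} with hS
  have hω0 : (ω₀ : V3) ≠ 0 := ne_zero_of_mem_unit_sphere ω₀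
  have hStop : S ≠ ⊤ := by
    intro htop
    have h1 : Module.finrank ℝ S = 1 := by rw [hS]; exact finrank_span_singleton hω0
    have h2 : Module.finrank ℝ S = Module.finrank ℝ V3 := by rw [htop, finrank_top]
    rw [h1, finrank_euclideanSpace_fin] at h2
    omega
  have hcone : Set.Ioo (0 : ℝ) 1 • (((↑) : Metric.sphere (0 : V3) 1 → V3) '' {ω₀}) ⊆ (S : Set V3) := by
    rintro _ ⟨r, -, _, ⟨ω, hω, rfl⟩, rfl⟩
    rw [Set.mem_singleton_iff] at hω
    subst hω
    show r • (ω : V3) ∈ S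
    rw [hS]
    exact Submodule.smul_mem _ _ (Submodule.subset_span rfl)
  rw [measure_mono_null hcone (Measure.addHaar_submodule _ S hStop), mul_zero]

/-- Thales: `v' = v - ⟪v - w, ω⟫ ω` lies on the sphere with diameter `[v, w]`. [folklore] -/
theorem collide_fst_mem_sphere (v w : V3) (ω : Metric.sphere (0 : V3) 1) :
    (collide ω (v, w)).1 ∈ Metric.sphere ((1 / 2 : ℝ) • (v + w)) (‖v - w‖ / 2) := by
  have hω1 : ‖(ω : V3)‖ = 1 := norm_eq_of_mem_sphere ω
  rw [Metric.mem_sphere, dist_eq_norm]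
  have hp : (collide ω (v, w)).1 - (1 / 2 : ℝ) • (v + w) =
      (1 / 2 : ℝ) • (v - w) - ⟪v - w, (ω : V3)⟫_ℝ • (ω : V3) := by
    simp only [collide]
    module
  rw [hp]
  have hsq : ‖(1 / 2 : ℝ) • (v - w) - ⟪v - w, (ω : V3)⟫_ℝ • (ω : V3)‖ ^ 2 = (‖v - w‖ / 2) ^ 2 := by
    rw [norm_sub_sq_real, real_inner_smul_left, real_inner_smul_right, norm_smul, norm_smul, hω1,
      Real.norm_eq_abs, Real.norm_eq_abs, abs_of_pos (by norm_num : (0 : ℝ) < 1 / 2), mul_one,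
      mul_pow, sq_abs]
    ring
  exact (pow_left_inj₀ (norm_nonneg _) (by positivity) two_ne_zero).1 hsq

/-- For `⟪v - w, ω⟫ > 0` the impact direction is recovered from `v'`. [folklore] -/
theorem coe_eq_of_collide {v w : V3} {ω : Metric.sphere (0 : V3) 1}
    (ht : 0 < ⟪v - w, (ω : V3)⟫_ℝ) :
    (ω : V3) = ‖v - (collide ω (v, w)).1‖⁻¹ • (v - (collide ω (v, w)).1) := by
  have hp : v - (collide ω (v, w)).1 = ⟪v - w, (ω : V3)⟫_ℝ • (ω : V3) := by
    simp only [collide]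
    exact sub_sub_cancel _ _
  rw [hp, norm_smul, norm_eq_of_mem_sphere ω, mul_one, Real.norm_eq_abs, abs_of_pos ht, smul_smul,
    inv_mul_cancel₀ ht.ne', one_smul]

/-- The kernel vanishes unless `⟪v - w, ω⟫ > 0`. [folklore] -/
theorem kernel_eq_zero_of_not_pos {v w : V3} {ω : Metric.sphere (0 : V3) 1}
    (h : ¬ 0 < ⟪v - w, (ω : V3)⟫_ℝ) : hardSphereKernel (v, w) ω = 0 := by
  unfold hardSphereKernel
  exact max_eq_right (not_lt.1 h)

/-- On each collision sphere a sphere-countable set is invisible: if `f = 1` off `A` and `A` meets every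
round sphere countably, the inner collision integral of `f` equals the `f ≡ 1` one. [folklore] -/
theorem inner_integral_eq {A : Set V3}
    (hS : ∀ (c : V3) (ρ : ℝ), (A ∩ Metric.sphere c ρ).Countable) {f : V3 → ℝ}
    (hf : ∀ x, x ∉ A → f x = 1) (v w : V3) :
    ∫ ω, hardSphereKernel (v, w) ω * globalMaxwellian w * f (collide ω (v, w)).1 ∂sphereMeasure =
      ∫ ω, hardSphereKernel (v, w) ω * globalMaxwellian w ∂sphereMeasure := by
  set D : Set (Metric.sphere (0 : V3) 1) :=
    {ω | 0 < ⟪v - w, (ω : V3)⟫_ℝ ∧ (collide ω (v, w)).1 ∈ A} with hD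
  set C : Set V3 := A ∩ Metric.sphere ((1 / 2 : ℝ) • (v + w)) (‖v - w‖ / 2) with hC
  have hCc : C.Countable := hS _ _
  let F : V3 → Set (Metric.sphere (0 : V3) 1) :=
    fun p => {ω | (ω : V3) = ‖v - p‖⁻¹ • (v - p)}
  have hsub : D ⊆ ⋃ p ∈ C, F p := by
    intro ω hω
    obtain ⟨ht, hA⟩ := hω
    refine Set.mem_iUnion₂.2 ⟨(collide ω (v, w)).1, ⟨hA, collide_fst_mem_sphere v w ω⟩, ?_⟩
    exact coe_eq_of_collide ht
  have hF : ∀ p, (sphereMeasure : Measure (Metric.sphere (0 : V3) 1)) (F p) = 0 := by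
    intro p
    rcases (F p).eq_empty_or_nonempty with h | ⟨ω₀, hω₀⟩
    · rw [h, measure_empty]
    · have : F p = {ω₀} := by
        refine Set.eq_singleton_iff_unique_mem.2 ⟨hω₀, fun ω hω => Subtype.ext ?_⟩
        exact (show (ω : V3) = _ from hω).trans (show (ω₀ : V3) = _ from hω₀).symm
      rw [this]
      exact sphereMeasure_singleton ω₀
  have hnull : (sphereMeasure : Measure (Metric.sphere (0 : V3) 1)) D = 0 :=
    measure_mono_null hsub ((measure_biUnion_null_iff hCc).2 fun p _ => hF p)
  have hae : ∀ᵐ ω ∂(sphereMeasure : Measure (Metric.sphere (0 : V3) 1)), ω ∉ D := by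
    rw [ae_iff]
    simpa only [not_not, Set.setOf_mem_eq] using hnull
  refine integral_congr_ae ?_
  filter_upwards [hae] with ω hω
  by_cases ht : 0 < ⟪v - w, (ω : V3)⟫_ℝ
  · have hA : (collide ω (v, w)).1 ∉ A := fun h => hω ⟨ht, h⟩
    rw [hf _ hA, mul_one]
  · rw [kernel_eq_zero_of_not_pos ht]; simp

/-- Hence `K f = 1` identically for such `f` (in particular `K 1 = 1`: `K` is Markov). [folklore] -/
theorem K_eq_one {A : Set V3}
    (hS : ∀ (c : V3) (ρ : ℝ), (A ∩ Metric.sphere c ρ).Countable) {f : V3 → ℝ}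
    (hf : ∀ x, x ∉ A → f x = 1) (v : V3) :
    (∫ w, ∫ ω, hardSphereKernel (v, w) ω * globalMaxwellian w ∂sphereMeasure)⁻¹ *
        ∫ w, ∫ ω, hardSphereKernel (v, w) ω * globalMaxwellian w * f (collide ω (v, w)).1 ∂sphereMeasure =
      1 := by
  have hfun : (fun w => ∫ ω, hardSphereKernel (v, w) ω * globalMaxwellian w *
      f (collide ω (v, w)).1 ∂sphereMeasure) =
      fun w => ∫ ω, hardSphereKernel (v, w) ω * globalMaxwellian w ∂sphereMeasure :=
    funext (inner_integral_eq hS hf v)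
  rw [hfun]
  exact inv_mul_cancel₀ (nu_pos v).ne'

/-- Bochner junk: if `f ⁻¹' {-1}` is not null-measurable, the "mean" `∫ f dπ` is `0` by definition. [folklore] -/
theorem integral_eq_zero_of_not_nullMeasurable {f : V3 → ℝ}
    (hA : ¬ NullMeasurableSet (f ⁻¹' {(-1 : ℝ)}) volume) :
    ∫ v, f v * ((∫ w, ∫ ω, hardSphereKernel (v, w) ω * globalMaxwellian w ∂sphereMeasure) *
      globalMaxwellian v) = 0 := by
  apply integral_undef
  intro hI
  apply hA
  have hprod := hI.aestronglyMeasurable.aemeasurable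
  have hf : AEMeasurable f volume := by
    refine (hprod.div measurable_nuM.aemeasurable).congr (ae_of_all _ fun v => ?_)
    have hne : (∫ w, ∫ ω, hardSphereKernel (v, w) ω * globalMaxwellian w ∂sphereMeasure) *
        globalMaxwellian v ≠ 0 :=
      (mul_pos (nu_pos v) (globalMaxwellian_pos v)).ne'
    simp only [Pi.div_apply]
    exact mul_div_cancel_right₀ _ hne
  exact hf.nullMeasurable (measurableSet_singleton _)

end SpectralContractionRWithoutMeasurable

open SpectralContractionRWithoutMeanZero (nu_eq nu_pos integrable_nuM integral_nuM_pos) in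
open SpectralContractionRWithoutMeasurable in
/-- ANY PROOF MUST USE MEASURABILITY: without it the ±1 sign pattern of the Sierpiński sphere set
(`Literature.MeasureTheory.Lebesgue.exists_sierpinskiSphereSet`: not null-measurable, finite on every round
sphere) meets the integrability hypothesis (`f² = 1`), meets mean-zero BY BOCHNER JUNK, and has `K f = 1`, so the
conclusion reads `Z ≤ cZ`. (= the landed `InformationPercolationEngineSpectralContraction_refuted`, whose
statement's decl was retired by the rev-3 repair.) [folklore] -/
theorem spectralContractionR_false_without_measurable : ¬ SpectralContractionRWithoutMeasurable := by
  classical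
  obtain ⟨A, hA, hfin⟩ := Literature.MeasureTheory.Lebesgue.exists_sierpinskiSphereSet
  have hS : ∀ (c : V3) (ρ : ℝ), (A ∩ Metric.sphere c ρ).Countable := fun c ρ => (hfin c ρ).countable
  set f : V3 → ℝ := fun x => if x ∈ A then -1 else 1 with hfdef
  have hf1 : ∀ x, x ∉ A → f x = 1 := fun x hx => by simp only [hfdef, if_neg hx]
  have hfsq : ∀ x, f x ^ 2 = 1 := fun x => by
    simp only [hfdef]; split_ifs <;> norm_num
  have hpre : f ⁻¹' {(-1 : ℝ)} = A := by
    ext x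
    simp only [Set.mem_preimage, Set.mem_singleton_iff, hfdef]
    split_ifs with h
    · simp [h]
    · simp only [h, iff_false]; norm_num
  rintro ⟨c, hc, h⟩
  have hint : Integrable (fun v : V3 => f v ^ 2 *
      ((∫ w, ∫ ω, hardSphereKernel (v, w) ω * globalMaxwellian w ∂sphereMeasure) *
        globalMaxwellian v)) := by
    refine integrable_nuM.congr (Eventually.of_forall fun v => ?_)
    simp only [hfsq, one_mul]
  have hmean : ∫ v, f v * ((∫ w, ∫ ω, hardSphereKernel (v, w) ω * globalMaxwellian w ∂sphereMeasure) *
      globalMaxwellian v) = 0 :=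
    integral_eq_zero_of_not_nullMeasurable (hpre.symm ▸ hA)
  have h1 := h f hint hmean
  simp only [K_eq_one hS hf1, hfsq, one_pow, one_mul] at h1
  have hZ := integral_nuM_pos
  nlinarith

end Summit.AtomisticToContinuum.HydrodynamicLimit.Theorems

end
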